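/-
Copyright: b2b-lace packet (numerics seat num5 = engine-B twin #2, gen 12).  Elementary analytic
ingredients of the term-wise seed certificate SEEDCERT-P (`b2b-lace-num5-g12/SEEDCERT-P.md`):
monotonicity of the even return probabilities of the simple random walk, the Poisson–Bessel
"unsmoothing" inequality (Lemma P), rational enclosures of `I₀` and of the `cosh` partial sums,
the resulting oracle-free block constant, and a Debye/Stirling closed form for the far tail.
-/
import Literature.Barriers.CriticalPhenomena.RigorousRGSmallParameterHeatKernel
import Literature.Probability.LatticeModels.BesselIDebyeAsymptotics
import Mathlib.Analysis.SpecialFunctions.Stirling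
import HarnessLib

/-!
# Poisson–Bessel unsmoothing for the SRW return probabilities

Write `p_n(x) = srwLaw d n x` for the `n`-step transition probability of the simple random walk on
`ℤ^d` and `q_m = p_{2m}(0)`.  The exponential generating function of the return probabilities
factorises over the coordinates, `Σ_n p_n(0) tⁿ/n! = (2π)^{-d} ∫_{[-π,π]^d} e^{t μ(k)} dk`,
`μ(k) = d⁻¹ Σ_j cos k_j`, and symmetrising in `t` gives `∫ cosh(t μ(k)) dk = (2π)^d I₀(t/d)^d`.
Since `m ↦ q_m` is non-increasing (`srwLaw_two_mul_zero_antitone`), truncating the `cosh` series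
yields **Lemma P**: `q_m · Σ_{j ≤ m} t^{2j}/(2j)! ≤ I₀(t/d)^d` for every `t ≥ 0`
(`srwLaw_mul_coshPartialSum_le`).  Together with `p_i(x) ≤ q_m` for `2m ≤ i`
(`srwLaw_le_srwLaw_two_mul_zero`, from the tree's `srwLaw_le_srwLaw_even_zero`), the power-series
upper enclosure of `I₀` (`besselI_zero_le_partialSum_add_tail`) and the lower enclosure of the
`cosh` partial sum (`cosh_sub_tail_le_coshPartialSum`) this gives a bound on every `p_i(x)`,
`i ≥ 2m`, by a closed expression in rational operations on `t`, `d`, `m` (`srwLaw_le_blockConst`),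
and, with the tree's Debye envelope `besselI_mem_Icc_debye` and Mathlib's Stirling bound, the
closed form `srwLaw_two_mul_zero_le_farTail` decaying like `m^{-d/2}`.  All statements are
[folklore]; they are the analytic half of a term-wise enclosure of the lace-expansion seed
integrals `I_{n,0}(x; d) = Σ_i C(i+n-1, n-1) p_i(x)` by exact partial sums plus a rigorous tail.

* `srwLaw_two_mul_succ_zero_le`, `srwLaw_two_mul_zero_antitone` — `q_{m+1} ≤ q_m`;
* `setIntegral_brillouin_cosh_mul_avgCos` — `∫_{[-π,π]^d} cosh(t μ(k)) dk = (2π)^d I₀(t/d)^d`;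
* `srwLaw_mul_coshPartialSum_le` — Lemma P;
* `besselI_zero_le_partialSum_add_tail`, `cosh_sub_tail_le_coshPartialSum` — series enclosures;
* `srwLaw_le_blockConst` — the block constant; `srwLaw_two_mul_zero_le_farTail` — the far tail.
-/

namespace Literature.Barriers.CriticalPhenomena.LongRangePhi4

open _root_.MeasureTheory Literature.Probability.LatticeModels Finset
open scoped BigOperators Nat

variable {d : ℕ}

/-- (Lq) The even return probabilities are non-increasing: `p_{2(m+1)}(0) ≤ p_{2m}(0)`. [folklore] -/
theorem srwLaw_two_mul_succ_zero_le (hd : 1 ≤ d) (m : ℕ) :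
    srwLaw d (2 * (m + 1)) 0 ≤ srwLaw d (2 * m) 0 := by
  have h2 : 2 * (m + 1) = 2 + 2 * m := by ring
  rw [h2, srwLaw_add hd 2 (2 * m) 0]
  have hs₁ : Summable fun y : Site d => srwLaw d 2 y * srwLaw d (2 * m) (0 - y) :=
    summable_srwLaw_mul hd 2 (2 * m) (fun y => 0 - y)
  have hs₂ : Summable fun y : Site d => srwLaw d 2 y * srwLaw d (2 * m) 0 :=
    (hasSum_srwLaw hd 2).summable.mul_right _
  calc ∑' y : Site d, srwLaw d 2 y * srwLaw d (2 * m) (0 - y)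
      ≤ ∑' y : Site d, srwLaw d 2 y * srwLaw d (2 * m) 0 :=
        Summable.tsum_le_tsum (fun y => mul_le_mul_of_nonneg_left (srwLaw_two_mul_le hd m _)
          (srwLaw_nonneg _ _)) hs₁ hs₂
    _ = srwLaw d (2 * m) 0 := by rw [tsum_mul_right, (hasSum_srwLaw hd 2).tsum_eq, one_mul]

/-- (Lq') `m ↦ p_{2m}(0)` is antitone. [folklore] -/
theorem srwLaw_two_mul_zero_antitone (hd : 1 ≤ d) : Antitone fun m : ℕ => srwLaw d (2 * m) 0 :=
  antitone_nat_of_succ_le fun m => srwLaw_two_mul_succ_zero_le hd m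

/-- `∫_{[-π,π]} e^{u cos θ} dθ = 2π I₀(u)`. [folklore] -/
theorem setIntegral_exp_mul_cos_Icc (u : ℝ) :
    ∫ θ in Set.Icc (-Real.pi) Real.pi, Real.exp (u * Real.cos θ) = 2 * Real.pi * besselI 0 u := by
  have h := besselI_eq_integral_cosh u 0 0
  simp only [Int.cast_zero, zero_mul, neg_zero, Real.exp_zero, Real.cosh_zero, Real.sinh_zero,
    mul_one, mul_zero, sub_zero, Real.cos_zero, one_div] at h
  rw [integral_Icc_eq_integral_Ioc, ← intervalIntegral.integral_of_le (by linarith [Real.pi_pos])]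
  have hπ : (0 : ℝ) < 2 * Real.pi := by positivity
  rw [h]
  field_simp

/-- `∫_{[-π,π]^d} e^{s Σ_j cos k_j} dk = (2π I₀(s))^d`. [folklore] -/
theorem setIntegral_brillouin_exp_mul_sum_cos (s : ℝ) :
    ∫ k in brillouin d, Real.exp (∑ j, s * Real.cos (k j)) = (2 * Real.pi * besselI 0 s) ^ d := by
  simp_rw [Real.exp_sum]
  change ∫ k, ∏ j, Real.exp (s * Real.cos (k j)) ∂((volume : Measure (Fin d → ℝ)).restrict (brillouin d)) = _
  rw [volume_restrict_brillouin, integral_fintype_prod_eq_pow (f := fun θ => Real.exp (s * Real.cos θ)),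
    Fintype.card_fin, setIntegral_exp_mul_cos_Icc]

/-- `∫_{[-π,π]^d} cosh(t μ(k)) dk = (2π)^d I₀(t/d)^d` (`μ(k) = d⁻¹Σ cos k_j`). [folklore] -/
theorem setIntegral_brillouin_cosh_mul_avgCos (t : ℝ) :
    ∫ k in brillouin d, Real.cosh (t * avgCos d k) = (2 * Real.pi) ^ d * besselI 0 (t / d) ^ d := by
  have e : ∀ k : Fin d → ℝ, t * avgCos d k = ∑ j, t / d * Real.cos (k j) := by
    intro k; rw [avgCos, ← Finset.mul_sum]; ring
  have e' : ∀ k : Fin d → ℝ, -(t * avgCos d k) = ∑ j, (-t) / d * Real.cos (k j) := by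
    intro k; rw [e, ← Finset.sum_neg_distrib]; refine Finset.sum_congr rfl fun j _ => by ring
  simp_rw [Real.cosh_eq, e', e]
  rw [integral_div, integral_add, setIntegral_brillouin_exp_mul_sum_cos,
    setIntegral_brillouin_exp_mul_sum_cos]
  · have hneg : besselI 0 (-t / d) = besselI 0 (t / d) := by
      rw [neg_div, besselI_neg_arg]; simp
    rw [hneg, mul_pow]; ring
  · simp_rw [← e, ]
    exact integrableOn_brillouin_of_continuous (Real.continuous_exp.comp (continuous_const.mul continuous_avgCos))
  · simp_rw [← e']
    exact integrableOn_brillouin_of_continuous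
      (Real.continuous_exp.comp ((continuous_const.mul continuous_avgCos).neg))

/-- **LEMMA P** (Poisson–Bessel unsmoothing, cosh form): for `d ≥ 1`, `m : ℕ`, `t ≥ 0`,
`p_{2m}(0) · Σ_{j ≤ m} t^{2j}/(2j)! ≤ I₀(t/d)^d`. [folklore] -/
theorem srwLaw_mul_coshPartialSum_le (hd : 1 ≤ d) (m : ℕ) {t : ℝ} (ht : 0 ≤ t) :
    srwLaw d (2 * m) 0 * ∑ j ∈ range (m + 1), t ^ (2 * j) / ((2 * j)! : ℝ)
      ≤ besselI 0 (t / d) ^ d := by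
  have h2π : (0 : ℝ) < (2 * Real.pi) ^ d := by positivity
  -- Step 1: monotonicity of q
  have step1 : srwLaw d (2 * m) 0 * ∑ j ∈ range (m + 1), t ^ (2 * j) / ((2 * j)! : ℝ)
      ≤ ∑ j ∈ range (m + 1), srwLaw d (2 * j) 0 * (t ^ (2 * j) / ((2 * j)! : ℝ)) := by
    rw [Finset.mul_sum]
    refine Finset.sum_le_sum fun j hj => ?_
    have hjm : j ≤ m := Nat.lt_succ_iff.mp (Finset.mem_range.mp hj)
    exact mul_le_mul_of_nonneg_right (srwLaw_two_mul_zero_antitone hd hjm) (by positivity)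
  refine step1.trans ?_
  -- Step 2: Fourier representation of each q_j
  have four : ∀ j : ℕ, srwLaw d (2 * j) 0 =
      (∫ k in brillouin d, avgCos d k ^ (2 * j)) / (2 * Real.pi) ^ d := by
    intro j
    have h := setIntegral_avgCos_pow_mul_cos hd (2 * j) 0
    have hph : ∀ k : Fin d → ℝ, phase k (0 : Site d) = 0 := by intro k; simp [phase]
    simp_rw [hph, Real.cos_zero, mul_one] at h
    rw [h]; field_simp
  simp_rw [four]
  -- Step 3: assemble the finite sum under the integral
  have hint : ∀ j ∈ range (m + 1), Integrable (fun k => t ^ (2 * j) / ((2 * j)! : ℝ) * avgCos d k ^ (2 * j))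
      ((volume : Measure (Fin d → ℝ)).restrict (brillouin d)) := fun j _ =>
    integrableOn_brillouin_of_continuous (continuous_const.mul (continuous_avgCos.pow _))
  have eq3 : ∑ j ∈ range (m + 1), (∫ k in brillouin d, avgCos d k ^ (2 * j)) / (2 * Real.pi) ^ d *
        (t ^ (2 * j) / ((2 * j)! : ℝ))
      = (∫ k in brillouin d, ∑ j ∈ range (m + 1), t ^ (2 * j) / ((2 * j)! : ℝ) * avgCos d k ^ (2 * j))
          / (2 * Real.pi) ^ d := by
    rw [integral_finsetSum _ hint, Finset.sum_div]
    refine Finset.sum_congr rfl fun j _ => ?_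
    rw [integral_const_mul]; ring
  rw [eq3, div_le_iff₀ h2π]
  -- Step 4: pointwise bound by cosh and integration
  have hcosh : ∀ k : Fin d → ℝ, ∑ j ∈ range (m + 1), t ^ (2 * j) / ((2 * j)! : ℝ) * avgCos d k ^ (2 * j)
      ≤ Real.cosh (t * avgCos d k) := by
    intro k
    have hs := Real.hasSum_cosh (t * avgCos d k)
    have e : ∀ j, t ^ (2 * j) / ((2 * j)! : ℝ) * avgCos d k ^ (2 * j) = (t * avgCos d k) ^ (2 * j) / ↑(2 * j)! := by
      intro j; rw [mul_pow]; ring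
    simp_rw [e]
    exact sum_le_hasSum _ (fun j _ => div_nonneg (by rw [pow_mul]; positivity) (Nat.cast_nonneg _)) hs
  calc ∫ k in brillouin d, ∑ j ∈ range (m + 1), t ^ (2 * j) / ((2 * j)! : ℝ) * avgCos d k ^ (2 * j)
      ≤ ∫ k in brillouin d, Real.cosh (t * avgCos d k) := by
        refine integral_mono (integrable_finsetSum _ hint) ?_ hcosh
        exact integrableOn_brillouin_of_continuous (Real.continuous_cosh.comp (continuous_const.mul continuous_avgCos))
    _ = (2 * Real.pi) ^ d * besselI 0 (t / d) ^ d := setIntegral_brillouin_cosh_mul_avgCos t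
    _ = besselI 0 (t / d) ^ d * (2 * Real.pi) ^ d := mul_comm _ _

/-- `besselITerm 0 u k = (u/2)^{2k}/(k!)^2`. [folklore] -/
theorem besselITerm_zero_eq (u : ℝ) (k : ℕ) :
    besselITerm 0 u k = (u / 2) ^ (2 * k) / ((k ! : ℝ) ^ 2) := by
  simp [besselITerm, sq]

/-- Ratio of consecutive `I₀` series terms: `a_{k+1} = a_k · u²/(4(k+1)²)`. [folklore] -/
theorem besselITerm_zero_succ (u : ℝ) (k : ℕ) :
    besselITerm 0 u (k + 1) = besselITerm 0 u k * (u ^ 2 / (4 * ((k : ℝ) + 1) ^ 2)) := by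
  rw [besselITerm_zero_eq, besselITerm_zero_eq, Nat.factorial_succ, Nat.cast_mul, Nat.cast_succ]
  have hk : ((k ! : ℕ) : ℝ) ≠ 0 := by positivity
  field_simp
  ring

/-- **(I0)** Power-series upper bound for `I₀(u)`, `u ≥ 0`: for `u² < 4(J+1)²`,
`I₀(u) ≤ Σ_{k ≤ J} a_k + a_{J+1} / (1 − u²/(4(J+1)²))`, `a_k = (u/2)^{2k}/(k!)²`
(geometric majorant of the tail, ratio `a_{k+1}/a_k = u²/(4(k+1)²) ≤ u²/(4(J+1)²)` for `k > J`). [folklore] -/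
theorem besselI_zero_le_partialSum_add_tail {u : ℝ} (hu : 0 ≤ u) (J : ℕ)
    (hJ : u ^ 2 < 4 * ((J : ℝ) + 1) ^ 2) :
    besselI 0 u ≤ ∑ k ∈ range (J + 1), besselITerm 0 u k
      + besselITerm 0 u (J + 1) / (1 - u ^ 2 / (4 * ((J : ℝ) + 1) ^ 2)) := by
  set r := u ^ 2 / (4 * ((J : ℝ) + 1) ^ 2) with hr
  have hr0 : 0 ≤ r := by positivity
  have hr1 : r < 1 := by rw [hr, div_lt_one (by positivity)]; exact hJ
  have hs := summable_besselITerm 0 u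
  rw [besselI, ← hs.sum_add_tsum_nat_add (J + 1)]
  gcongr
  have tail : ∀ i : ℕ, besselITerm 0 u (i + (J + 1)) ≤ besselITerm 0 u (J + 1) * r ^ i := by
    intro i
    induction i with
    | zero => simp
    | succ i ih =>
      have h1 : besselITerm 0 u (i + 1 + (J + 1)) =
          besselITerm 0 u (i + (J + 1)) * (u ^ 2 / (4 * (((i + (J + 1) : ℕ) : ℝ) + 1) ^ 2)) := by
        rw [show i + 1 + (J + 1) = (i + (J + 1)) + 1 by ring]; exact besselITerm_zero_succ u _
      rw [h1, show r ^ (i + 1) = r ^ i * r from pow_succ r i, ← mul_assoc]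
      refine mul_le_mul ih ?_ (by positivity)
        (mul_nonneg (besselITerm_nonneg hu 0 _) (pow_nonneg hr0 _))
      rw [hr]
      have hle : (J : ℝ) + 1 ≤ ((i + (J + 1) : ℕ) : ℝ) + 1 := by push_cast; linarith
      have hJ1 : (0 : ℝ) < (J : ℝ) + 1 := by positivity
      gcongr
  have hsum_tail : Summable fun i => besselITerm 0 u (i + (J + 1)) :=
    (summable_nat_add_iff (J + 1)).mpr hs
  calc ∑' i, besselITerm 0 u (i + (J + 1)) ≤ ∑' i, besselITerm 0 u (J + 1) * r ^ i :=
        Summable.tsum_le_tsum tail hsum_tail ((summable_geometric_of_lt_one hr0 hr1).mul_left _)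
    _ = besselITerm 0 u (J + 1) / (1 - r) := by
        rw [tsum_mul_left, tsum_geometric_of_lt_one hr0 hr1, div_eq_mul_inv]

/-- Ratio of consecutive `cosh` series terms: `c_{j+1} = c_j · y²/((2j+1)(2j+2))`. [folklore] -/
theorem coshTerm_succ (y : ℝ) (j : ℕ) :
    y ^ (2 * (j + 1)) / ((2 * (j + 1))! : ℝ)
      = y ^ (2 * j) / ((2 * j)! : ℝ) * (y ^ 2 / ((2 * (j : ℝ) + 1) * (2 * (j : ℝ) + 2))) := by
  have hf : ((2 * (j + 1))! : ℝ) = (2 * j)! * ((2 * (j : ℝ) + 1) * (2 * (j : ℝ) + 2)) := by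
    rw [show 2 * (j + 1) = (2 * j + 1) + 1 by ring, Nat.factorial_succ, Nat.factorial_succ]
    push_cast; ring
  have h0 : ((2 * j)! : ℝ) ≠ 0 := by positivity
  rw [hf, pow_mul, pow_mul, pow_succ]
  field_simp

/-- **(E_low)** Lower bound for the `cosh` partial sum: for `y ≥ 0` and `y² < (2m+3)(2m+4)`,
`cosh y − c_{m+1}/(1 − y²/((2m+3)(2m+4))) ≤ Σ_{j ≤ m} y^{2j}/(2j)!` (geometric tail majorant). [folklore] -/
theorem cosh_sub_tail_le_coshPartialSum (y : ℝ) (m : ℕ)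
    (hm : y ^ 2 < (2 * (m : ℝ) + 3) * (2 * (m : ℝ) + 4)) :
    Real.cosh y - (y ^ (2 * (m + 1)) / ((2 * (m + 1))! : ℝ)) /
        (1 - y ^ 2 / ((2 * (m : ℝ) + 3) * (2 * (m : ℝ) + 4)))
      ≤ ∑ j ∈ range (m + 1), y ^ (2 * j) / ((2 * j)! : ℝ) := by
  set c : ℕ → ℝ := fun j => y ^ (2 * j) / ((2 * j)! : ℝ) with hc
  set ρ := y ^ 2 / ((2 * (m : ℝ) + 3) * (2 * (m : ℝ) + 4)) with hρ
  have hρ0 : 0 ≤ ρ := by positivity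
  have hρ1 : ρ < 1 := by rw [hρ, div_lt_one (by positivity)]; exact hm
  have hs : HasSum c (Real.cosh y) := Real.hasSum_cosh y
  have hsum := hs.summable
  have split := hsum.sum_add_tsum_nat_add (m + 1)
  rw [hs.tsum_eq] at split
  -- tail bound
  have tail : ∀ i : ℕ, c (i + (m + 1)) ≤ c (m + 1) * ρ ^ i := by
    intro i
    induction i with
    | zero => simp
    | succ i ih =>
      have h1 : c (i + 1 + (m + 1)) = c (i + (m + 1)) *
          (y ^ 2 / ((2 * ((i + (m + 1) : ℕ) : ℝ) + 1) * (2 * ((i + (m + 1) : ℕ) : ℝ) + 2))) := by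
        rw [show i + 1 + (m + 1) = (i + (m + 1)) + 1 by ring]; exact coshTerm_succ y _
      rw [h1, show ρ ^ (i + 1) = ρ ^ i * ρ from pow_succ ρ i, ← mul_assoc]
      have hcn : 0 ≤ c (i + (m + 1)) := by simp only [hc]; rw [pow_mul]; positivity
      refine mul_le_mul ih ?_ (by positivity) (mul_nonneg (by simp only [hc]; rw [pow_mul]; positivity) (pow_nonneg hρ0 _))
      rw [hρ]
      have hle : 2 * (m : ℝ) + 3 ≤ 2 * ((i + (m + 1) : ℕ) : ℝ) + 1 := by push_cast; linarith
      have hle' : 2 * (m : ℝ) + 4 ≤ 2 * ((i + (m + 1) : ℕ) : ℝ) + 2 := by push_cast; linarith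
      have hp : (0 : ℝ) < 2 * (m : ℝ) + 3 := by positivity
      have hp' : (0 : ℝ) < 2 * (m : ℝ) + 4 := by positivity
      gcongr
  have hsum_tail : Summable fun i => c (i + (m + 1)) := (summable_nat_add_iff (m + 1)).mpr hsum
  have htail : ∑' i, c (i + (m + 1)) ≤ c (m + 1) / (1 - ρ) := by
    calc ∑' i, c (i + (m + 1)) ≤ ∑' i, c (m + 1) * ρ ^ i :=
          Summable.tsum_le_tsum tail hsum_tail ((summable_geometric_of_lt_one hρ0 hρ1).mul_left _)
      _ = c (m + 1) / (1 - ρ) := by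
          rw [tsum_mul_left, tsum_geometric_of_lt_one hρ0 hρ1, div_eq_mul_inv]
  have key : Real.cosh y - c (m + 1) / (1 - ρ) ≤ ∑ j ∈ range (m + 1), c j := by linarith
  simpa only [hc] using key

/-- (L1 + Lq) `p_i(x) ≤ q_m = p_{2m}(0)` whenever `2m ≤ i` (tree `srwLaw_le_srwLaw_even_zero` + (Lq')). [folklore] -/
theorem srwLaw_le_srwLaw_two_mul_zero (hd : 1 ≤ d) {i m : ℕ} (h : 2 * m ≤ i) (x : Site d) :
    srwLaw d i x ≤ srwLaw d (2 * m) 0 :=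
  (srwLaw_le_srwLaw_even_zero hd i x).trans (srwLaw_two_mul_zero_antitone hd (by omega))

/-- **Block constant** (oracle-free, all inputs kernel-checked above): for `d ≥ 1`, `t > 0` with a
positive cosh partial sum and `(t/d)² < 4(J+1)²`, every `p_i(x)` with `i ≥ 2m` is bounded by the
explicit rational-computable quantity `B^d / E_m(t)`, `B` = the (I0) majorant at `u = t/d`. [folklore] -/
theorem srwLaw_le_blockConst (hd : 1 ≤ d) {i m : ℕ} (h : 2 * m ≤ i) (x : Site d) {t : ℝ}
    (ht : 0 ≤ t) (J : ℕ) (hJ : (t / d) ^ 2 < 4 * ((J : ℝ) + 1) ^ 2)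
    (hE : 0 < ∑ j ∈ range (m + 1), t ^ (2 * j) / ((2 * j)! : ℝ)) :
    srwLaw d i x ≤
      (∑ k ∈ range (J + 1), besselITerm 0 (t / d) k
          + besselITerm 0 (t / d) (J + 1) / (1 - (t / d) ^ 2 / (4 * ((J : ℝ) + 1) ^ 2))) ^ d
        / ∑ j ∈ range (m + 1), t ^ (2 * j) / ((2 * j)! : ℝ) := by
  have hq := srwLaw_le_srwLaw_two_mul_zero hd h x
  have hP := srwLaw_mul_coshPartialSum_le hd m ht
  have htd : 0 ≤ t / d := div_nonneg ht (Nat.cast_nonneg _)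
  have hI := besselI_zero_le_partialSum_add_tail htd J hJ
  have hI0 : 0 ≤ besselI 0 (t / d) := besselI_nonneg htd 0
  rw [le_div_iff₀ hE]
  refine (mul_le_mul_of_nonneg_right hq hE.le).trans (hP.trans ?_)
  exact pow_le_pow_left₀ hI0 hI d

/-! ## Far tail: closed form beyond `M_END` -/


/-- Stirling consequence: `t^a / a! ≤ e^t / √(2πa)` for `t ≥ 0`, `a ≥ 1`. [folklore] -/
theorem pow_div_factorial_le_exp_div_sqrt {t : ℝ} (ht : 0 ≤ t) {a : ℕ} (ha : a ≠ 0) :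
    t ^ a / (a ! : ℝ) ≤ Real.exp t / √(2 * Real.pi * a) := by
  have hS := Stirling.le_factorial_stirling a
  have ha' : (0 : ℝ) < a := by exact_mod_cast Nat.pos_of_ne_zero ha
  have hsq : 0 < √(2 * Real.pi * a) := Real.sqrt_pos.2 (by positivity)
  have hpow : 0 < ((a : ℝ) / Real.exp 1) ^ a := by positivity
  have hden : 0 < √(2 * Real.pi * a) * ((a : ℝ) / Real.exp 1) ^ a := mul_pos hsq hpow
  -- step 1: replace a! by the Stirling minorant
  have h1 : t ^ a / (a ! : ℝ) ≤ t ^ a / (√(2 * Real.pi * a) * ((a : ℝ) / Real.exp 1) ^ a) :=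
    div_le_div_of_nonneg_left (pow_nonneg ht a) hden hS
  refine h1.trans ?_
  -- step 2: t^a / (a/e)^a = (e t / a)^a ≤ e^t
  have h2 : t ^ a / ((a : ℝ) / Real.exp 1) ^ a = (Real.exp 1 * (t / a)) ^ a := by
    rw [← div_pow]; congr 1; field_simp
  have h3 : (Real.exp 1 * (t / a)) ^ a ≤ Real.exp t := by
    have : Real.exp 1 * (t / a) ≤ Real.exp (t / a) := by
      have h := Real.add_one_le_exp (t / a - 1)
      calc Real.exp 1 * (t / a) = Real.exp 1 * ((t / a - 1) + 1) := by ring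
        _ ≤ Real.exp 1 * Real.exp (t / a - 1) := mul_le_mul_of_nonneg_left h (Real.exp_pos 1).le
        _ = Real.exp (t / a) := by rw [← Real.exp_add]; ring_nf
    calc (Real.exp 1 * (t / a)) ^ a ≤ (Real.exp (t / a)) ^ a :=
          pow_le_pow_left₀ (by positivity) this a
      _ = Real.exp t := by rw [← Real.exp_nat_mul]; congr 1; field_simp
  rw [mul_comm (√(2 * Real.pi * a)), ← div_div, h2]
  exact div_le_div_of_nonneg_right h3 hsq.le

/-- Debye envelope at order 0 (tree `besselI_mem_Icc_debye`): `I₀(u) ≤ (1 + 50/u) e^u/√(2πu)`, `u > 0`. [folklore] -/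
theorem besselI_zero_le_debye {u : ℝ} (hu : 0 < u) :
    besselI 0 u ≤ (1 + 50 / u) * (Real.exp u / √(2 * Real.pi * u)) := by
  have h := (besselI_mem_Icc_debye hu 0).2
  simp only [Int.cast_zero, zero_mul, sub_zero] at h
  have hs : √(u ^ 2 + (0 : ℝ) ^ 2) = u := by
    rw [zero_pow two_ne_zero, add_zero, Real.sqrt_sq hu.le]
  rw [hs] at h
  exact h

/-- **(FT) far-tail closed form.**  For `d ≥ 1`, `m ≥ 1`, `0 < λ < 1` and
`η := 2 / (√(2Real.pi(2m+2)) (1 − λ²)) < 1`, with `t = 2λm`: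
`q_m = p_{2m}(0) ≤ ((1 + 50d/t) e^{t/d} / √(2Real.pi t/d))^d / ((e^t/2)(1 − η))`
(= `2/(1−η) · (1 + 25d/(λm))^d · (d/(4Real.piλm))^{d/2}`).  Inputs: (P), (E_low), Stirling (Mathlib), tree Debye. [folklore] -/
theorem srwLaw_two_mul_zero_le_farTail (hd : 1 ≤ d) {m : ℕ} (hm : 1 ≤ m) {lam : ℝ}
    (h0 : 0 < lam) (h1 : lam < 1)
    (hη : 2 / (√(2 * Real.pi * ((2 * (m + 1) : ℕ) : ℝ)) * (1 - lam ^ 2)) < 1) :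
    srwLaw d (2 * m) 0 ≤
      ((1 + 50 / (2 * lam * m / d)) *
          (Real.exp (2 * lam * m / d) / √(2 * Real.pi * (2 * lam * m / d)))) ^ d /
        (Real.exp (2 * lam * m) / 2 *
          (1 - 2 / (√(2 * Real.pi * ((2 * (m + 1) : ℕ) : ℝ)) * (1 - lam ^ 2)))) := by
  set t := 2 * lam * m with ht_def
  set a : ℝ := ((2 * (m + 1) : ℕ) : ℝ) with ha_def
  have hm' : (1 : ℝ) ≤ m := by exact_mod_cast hm
  have hd' : (0 : ℝ) < d := by exact_mod_cast hd
  have ht : 0 < t := by positivity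
  have htm : t < 2 * m := by rw [ht_def]; nlinarith
  have h1l : 0 < 1 - lam ^ 2 := by nlinarith
  have ha : 0 < a := by rw [ha_def]; positivity
  have hsq : 0 < √(2 * Real.pi * a) := Real.sqrt_pos.2 (by positivity)
  have hη0 : 0 < 1 - 2 / (√(2 * Real.pi * a) * (1 - lam ^ 2)) := by linarith
  -- (P)
  have hP := srwLaw_mul_coshPartialSum_le hd m ht.le
  set E := ∑ j ∈ range (m + 1), t ^ (2 * j) / ((2 * j)! : ℝ) with hE_def
  -- (E_low)
  have hρ_hyp : t ^ 2 < (2 * (m : ℝ) + 3) * (2 * (m : ℝ) + 4) := by nlinarith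
  have hEl := cosh_sub_tail_le_coshPartialSum t m hρ_hyp
  -- the tail term
  have hc : t ^ (2 * (m + 1)) / ((2 * (m + 1))! : ℝ) ≤ Real.exp t / √(2 * Real.pi * a) :=
    pow_div_factorial_le_exp_div_sqrt ht.le (a := 2 * (m + 1)) (by omega)
  have hρ : t ^ 2 / ((2 * (m : ℝ) + 3) * (2 * (m : ℝ) + 4)) ≤ lam ^ 2 := by
    rw [div_le_iff₀ (by positivity), ht_def]; nlinarith
  have htail : t ^ (2 * (m + 1)) / ((2 * (m + 1))! : ℝ) /
        (1 - t ^ 2 / ((2 * (m : ℝ) + 3) * (2 * (m : ℝ) + 4)))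
      ≤ Real.exp t / √(2 * Real.pi * a) / (1 - lam ^ 2) :=
    div_le_div₀ (by positivity) hc h1l (by linarith)
  have hcosh : Real.exp t / 2 ≤ Real.cosh t := by
    rw [Real.cosh_eq]; have := Real.exp_pos (-t); linarith
  have hE : Real.exp t / 2 * (1 - 2 / (√(2 * Real.pi * a) * (1 - lam ^ 2))) ≤ E := by
    have expand : Real.exp t / 2 * (1 - 2 / (√(2 * Real.pi * a) * (1 - lam ^ 2)))
        = Real.exp t / 2 - Real.exp t / √(2 * Real.pi * a) / (1 - lam ^ 2) := by
      field_simp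
    rw [expand]
    linarith
  have hEpos0 : 0 < Real.exp t / 2 * (1 - 2 / (√(2 * Real.pi * a) * (1 - lam ^ 2))) :=
    mul_pos (by positivity) hη0
  have hEpos : 0 < E := lt_of_lt_of_le hEpos0 hE
  -- Debye
  have hu : 0 < t / d := by positivity
  have hI0 := besselI_zero_le_debye hu
  have hI0d : besselI 0 (t / d) ^ d ≤
      ((1 + 50 / (t / d)) * (Real.exp (t / d) / √(2 * Real.pi * (t / d)))) ^ d :=
    pow_le_pow_left₀ (besselI_nonneg hu.le 0) hI0 d
  have hq : srwLaw d (2 * m) 0 ≤ besselI 0 (t / d) ^ d / E := by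
    rw [le_div_iff₀ hEpos]; exact hP
  calc srwLaw d (2 * m) 0 ≤ besselI 0 (t / d) ^ d / E := hq
    _ ≤ ((1 + 50 / (t / d)) * (Real.exp (t / d) / √(2 * Real.pi * (t / d)))) ^ d / E :=
        div_le_div_of_nonneg_right hI0d hEpos.le
    _ ≤ ((1 + 50 / (t / d)) * (Real.exp (t / d) / √(2 * Real.pi * (t / d)))) ^ d /
          (Real.exp t / 2 * (1 - 2 / (√(2 * Real.pi * a) * (1 - lam ^ 2)))) :=
        div_le_div_of_nonneg_left (by positivity) hEpos0 hE

end Literature.Barriers.CriticalPhenomena.LongRangePhi4
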